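import Mathlib
import Literature.MathematicalPhysics.QuantumFieldTheory.Sweep1
import Literature.Probability.LatticeModels.FreeStateGibbs
import Literature.Probability.LatticeModels.GKSInequalities
import Literature.Probability.LatticeModels.HighDimTrivialityMoments
import Literature.Probability.LatticeModels.CriticalGibbsUniqueness
import Literature.Probability.LatticeModels.AizenmanWickBoundProofs
import Literature.Probability.LatticeModels.ImprovedTreeDiagramBoundSum
import Literature.Probability.LatticeModels.SlidingScaleInfraredBoundProofs
import Literature.Probability.LatticeModels.HighDimTrivialityAssemblyProofs
import Literature.Probability.LatticeModels.ImprovedTreeDiagramBoundHolds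
import HarnessLib

/-!
# `aizenmanDuminilCopin_charFun_bound` (constructive-qft.S24) is false as stated: single-site test functions

Trunk: ConstructiveQFT / StatMech. This file concerns the named fact
`Literature.MathematicalPhysics.QuantumFieldTheory.aizenmanDuminilCopin_charFun_bound` of `Sweep1`
(Aizenman–Duminil-Copin, Ann. Math. 194 (2021) 163, arXiv:1912.07973, Prop. 1.4 at `β = β_c`).

## What the source prints, and what it proves

Prop. 1.4 (arXiv:1912.07973 v3, p. 6): "There exist `c, C > 0` such that for the n.n.f. Ising
model on `ℤ⁴`, every `β ≤ β_c`, every `L ≤ ξ(β)`, and test function `f ∈ C_0(ℝ⁴)`,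
`|⟨exp[z T_{f,L}(σ) - (z²/2)⟨T_{f,L}(σ)²⟩_β]⟩_β - 1| ≤ C ‖f‖_∞⁴ r_f¹² z⁴ / (log L)^c`,
with `‖f‖_∞ := max{|f(x)| : x ∈ ℝ⁴}` and `r_f` the diameter of the function's support."
The proof (§6.3, p. 26) is written "for a continuous function `f` which vanishes outside
`[-r, r]⁴`" and closes with "all the sums (1)–(4) are sufficiently small (recall that by
definition `r ≥ 1`) and the claim is derived" — the bounds on the sums (3), (4) there carry
`r⁴`, `r⁸` rather than `r¹²`, so `r ≥ 1` is used.

`aizenmanDuminilCopin_charFun_bound` transcribes the display with `r_f = Metric.diam (tsupport f)`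
and no lower bound on `r_f`. **That statement is false**, by the following elementary
computation (no input from [ADC] is needed; only the existence of a critical DLR state with
non-negative pair correlations, both theorems of the tree): take the free DLR state `μ` at
`β_c` (`exists_freeMeasure_holds`), `L = 2`, and the bump `f_ε(y) = max(0, 1 - ‖y‖/ε)` with
`ε ≤ 1/2`. Only the origin contributes to `∑_x f_ε(x/2) σ_x`, so
`T := adcField μ f_ε 2 = σ₀ / Σ₂^{1/2}` with `Σ₂ = boxSpinVariance μ 2 ≥ 1` (Griffiths' first
inequality `freeCorr_nonneg` and `σ_x² = 1`), `⟨T²⟩ = 1/Σ₂`, and at `z = ±2 Σ₂^{1/2}` the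
left-hand side is `|e^{-2}(cosh 2 ± ⟨σ₀⟩ sinh 2) - 1|`; the two deviations add up to at least
`1 - e^{-4} > 1/2`, whereas the right-hand side `C · ‖f_ε‖_∞⁴ · diam(supp f_ε)¹² · z⁴/(log 2)^c
≤ C (2ε)¹² (2 Σ₂^{1/2})⁴/(log 2)^c` does not depend on `ε` otherwise (`Σ₂` is a property of `μ`
alone) and tends to `0` with `ε`. Hence `not_aizenmanDuminilCopin_charFun_bound`.

The same defect of the literal `diam(supp f)` reading was found for the barrier catalogue's
transcription `Literature.Barriers.CriticalPhenomena.criticalSmearedMGF_bound_four`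
(`not_criticalSmearedMGF_bound_four`, `IsingTrivialityFromDimensionFourProofs`); the argument
here is its analogue in the DLR-state vocabulary of `Sweep1` (`adcField`, `boxSpinVariance`).

## The corrected statement

The corrected (proved-in-print) form — `f` vanishing outside the cube `[-r, r]⁴`, `r ≥ 1`, bound
`C ‖f‖_∞⁴ r¹² z⁴/(log L)^c` — is ALREADY vendored in the tree, for every DLR state
`μ ∈ 𝒢(β, 0)`, `β ≤ β_c`, in `Literature.Probability.LatticeModels.HighDimTriviality(Moments)`:
`Literature.Probability.LatticeModels.aizenmanDuminilCopin_mgf_normalizedField_bound` (the display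
as printed, box radius `r ≥ 1`) and
`Literature.Probability.LatticeModels.aizenmanDuminilCopin_mgf_normalizedField_bound_abs` (the form
the printed proof establishes, prefactor `exp(z²/2 ⟨T_{|f|,L}²⟩)`; for `f ≥ 0` the two coincide,
`….of_nonneg`). It is not restated here (D-0026). In the vocabulary of `Sweep1` it is derived
from those facts as `aizenmanDuminilCopin_charFun_bound_boxRadius(_nonneg)` via the
identification `adcField_eq_normalizedField`.

## The Gaussian-limit fact of `Sweep1`

`aizenmanDuminilCopin_gaussian_limit` (every subsequential weak limit of the law of `T_{f,L_k}`
under a critical DLR state on `ℤ⁴` is a centred Gaussian; ADC Thm. 1.2 for the Ising case) is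
reduced to the single named fact
`Literature.Probability.LatticeModels.aizenmanDuminilCopin_mgf_normalizedField_bound_abs`
(`aizenmanDuminilCopin_gaussian_limit_of_bound_abs`), through the moment-generating-function
argument of `HighDimTriviality` Part II and the tree's theorem
`hasUniqueGibbsMeasure_criticalBeta_holds` (uniqueness at `β_c`), which supplies the variance
bound of ADC p. 6 (`integral_normalizedField_sq_le`). The intermediate reductions
`…_of_bound_abs_of_variance`, `…_of_bound_abs_of_unique`, `…_of_bounds` and six small helpers
restore, with the signatures recorded by the ledger, the content of proposals p27925/p28453
(unit `…QuantumFi-551125c82b`) that the whole-file proposal p27934 of this unit had removed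
(two units created this new sibling file concurrently).

## The trust base of `aizenmanDuminilCopin_gaussian_limit` (split review, 2026-08-15)

`aizenmanDuminilCopin_gaussian_limit` is the inventory item constructive-qft.S24 itself — not a
decomposition child of any fact — and a faithful (indeed weaker: one test function, one-dimensional
marginals, subsequential limits, `β = β_c`) form of ADC Thm. 1.2 for the nearest-neighbour Ising
model on `ℤ⁴` (p. 5: "included in Theorem 1.2 is the statement that for `d = 4` any scaling limit of
the critical Ising model is Gaussian"). Its entire proof obligation lies upstream, in
`Literature.Probability.LatticeModels`: ADC Prop. 1.4 in proof form
(`aizenmanDuminilCopin_mgf_normalizedField_bound_abs`, see above) is derived there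
(`aizenmanDuminilCopin_mgf_normalizedField_bound_abs_of_wickDeviation`, `AizenmanWickBound`) from
Aizenman 1982, Prop. 12.1 — a theorem of the tree, `aizenman_wickDeviation_le_finite_holds` — and the
`d = 4` bound `Σ_L⁻² ∑_{Λ_{rL}⁴} |U₄| ≤ C r¹² (log L)^{-c}` of §6.3
(`aizenmanDuminilCopin_ursellFourSum_le`), which `aizenmanDuminilCopin_ursellFourSum_le_of_facts`
(`ImprovedTreeDiagramBoundSum`) derives from the paper's numbered Theorem 1.3 (improved tree diagram
bound, `aizenmanDuminilCopin_improvedTreeDiagramBound`) and Theorem 5.6 (sliding-scale infrared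
bound, `aizenmanDuminilCopin_slidingScaleInfraredBound`), named facts of `ImprovedTreeDiagramBound`.
The compositions `aizenmanDuminilCopin_gaussian_limit_of_ursellFourSum_le` and
`aizenmanDuminilCopin_gaussian_limit_of_adcTheorems` below record this, so that the discharge
`aizenmanDuminilCopin_gaussian_limit_holds` is the one-liner
`aizenmanDuminilCopin_gaussian_limit_of_adcTheorems T13_holds T56_holds` once those two facts are
discharged; no split and no restatement of S24 is warranted.

## References

* M. Aizenman, H. Duminil-Copin, *Marginal triviality of the scaling limits of critical 4D Ising
  and `φ⁴₄` models*, Ann. of Math. 194 (2021) 163–235, arXiv:1912.07973: Prop. 1.4 (p. 6) and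
  its proof, §6.3 (p. 26) [AizenmanDuminilCopinAnnals2021].
* S. Friedli, Y. Velenik, *Statistical Mechanics of Lattice Systems* (CUP 2017), Thm. 3.20
  (GKS), Exercise 3.16 and Thm. 6.26 (the free state is a DLR state) [FriedliVelenik2017].
-/

noncomputable section

open MeasureTheory Filter Topology

namespace Literature.MathematicalPhysics.QuantumFieldTheory

open Literature.Probability.LatticeModels (SpinConfig spinAt box zero_mem_box spinCorr spinProduct
  criticalBeta criticalBeta_nonneg isingGibbsMeasures mem_isingGibbsMeasures_iff
  exists_freeMeasure_holds freeCorr_nonneg measurable_spinAt spinAt_mul_self spinAt_sq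
  spinAt_eq_one_or_eq_neg_one abs_spinAt IsGibbsMeasure.isProbabilityMeasure
  siteVec siteVec_apply latticeBox mem_latticeBox latticeBox_eq_box blockSpinVariance
  normalizedField normalizedField_eq_mul_sum sqMoment_eq_sum blockSpinVariance_eq_sqMoment
  aizenmanDuminilCopin_mgf_normalizedField_bound aizenmanDuminilCopin_mgf_normalizedField_bound_abs
  aizenmanDuminilCopin_mgf_normalizedField_bound_abs.of_nonneg
  normalizedField_eq_smearedSpin integrable_exp_mul_smearedSpin measurable_normalizedField
  exists_cube_of_hasCompactSupport iSup_abs_nonneg normalizedField_variance_bounds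
  hasUniqueGibbsMeasure_criticalBeta hasUniqueGibbsMeasure_criticalBeta_holds
  IsTranslationInvariantMeasure isTranslationInvariantMeasure_of_spinCorr_eq_freeCorr freeCorr
  integral_normalizedField_sq_le tendsto_integral_of_tendsto_of_sq_le
  exists_variance_of_tendsto_mgf eq_gaussianReal_of_mgf_eq)

/-- `Σ_L(μ) = ∑_{x,y ∈ Λ_L} ⟨σ_x σ_y⟩_μ ≥ 1` for a probability measure with non-negative pair
correlations: the diagonal terms are `⟨σ_x²⟩ = 1` and the origin lies in `Λ_L`
(Griffiths' first inequality; Friedli–Velenik 2017, Thm. 3.20). [cite: FriedliVelenik2017, Thm. 3.20] -/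
theorem one_le_boxSpinVariance {d : ℕ}
    (μ : Measure (SpinConfig (Literature.Probability.LatticeModels.Site d))) [IsProbabilityMeasure μ]
    (hμ : ∀ x y : Literature.Probability.LatticeModels.Site d, x ≠ y →
      0 ≤ ∫ σ, spinAt x σ * spinAt y σ ∂μ)
    (L : ℕ) : 1 ≤ boxSpinVariance μ L := by
  have hterm : ∀ x y : Literature.Probability.LatticeModels.Site d,
      0 ≤ ∫ σ, spinAt x σ * spinAt y σ ∂μ := by
    intro x y
    by_cases hxy : x = y
    · subst hxy; simp
    · exact hμ x y hxy
  unfold boxSpinVariance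
  calc (1 : ℝ) = ∫ σ, spinAt (0 : Literature.Probability.LatticeModels.Site d) σ * spinAt 0 σ ∂μ := by
        simp
    _ ≤ ∑ y ∈ box d L, ∫ σ, spinAt (0 : Literature.Probability.LatticeModels.Site d) σ * spinAt y σ ∂μ :=
        Finset.single_le_sum
          (f := fun y => ∫ σ, spinAt (0 : Literature.Probability.LatticeModels.Site d) σ * spinAt y σ ∂μ)
          (fun y _ => hterm 0 y) (zero_mem_box d L)
    _ ≤ ∑ x ∈ box d L, ∑ y ∈ box d L, ∫ σ, spinAt x σ * spinAt y σ ∂μ :=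
        Finset.single_le_sum (f := fun x => ∑ y ∈ box d L, ∫ σ, spinAt x σ * spinAt y σ ∂μ)
          (fun x _ => Finset.sum_nonneg fun y _ => hterm x y) (zero_mem_box d L)

/-- A non-zero site of `ℤ^d`, rescaled by `1/L` (`L ≥ 1`), has Euclidean norm at least `1/L`.
[folklore] -/
theorem inv_le_norm_toLp_div {d : ℕ} {x : Literature.Probability.LatticeModels.Site d} (hx : x ≠ 0)
    {L : ℝ} (hL : 0 < L) :
    L⁻¹ ≤ ‖(WithLp.toLp 2 fun i => (x i : ℝ) / L : EuclideanSpace ℝ (Fin d))‖ := by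
  obtain ⟨i, hi⟩ : ∃ i, x i ≠ 0 := by
    by_contra h
    push Not at h
    exact hx (funext h)
  have h1 : (1 : ℝ) ≤ |(x i : ℝ)| := by
    rw [← Int.cast_abs]
    exact_mod_cast Int.one_le_abs hi
  calc L⁻¹ = 1 / L := (one_div L).symm
    _ ≤ |(x i : ℝ)| / L := by gcongr
    _ = ‖(WithLp.toLp 2 fun j => (x j : ℝ) / L : EuclideanSpace ℝ (Fin d)) i‖ := by
        rw [Real.norm_eq_abs, abs_div, abs_of_pos hL]
    _ ≤ ‖(WithLp.toLp 2 fun j => (x j : ℝ) / L : EuclideanSpace ℝ (Fin d))‖ := PiLp.norm_apply_le _ i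

-- names the `@[deprecated]` record `aizenmanDuminilCopin_charFun_bound` of `Sweep1.lean` on purpose: this IS its
-- refutation (verdict clean-up 2026-08-15); REMOVE-WHEN the record is deleted from `Sweep1.lean`
set_option linter.deprecated false in
/-- **`aizenmanDuminilCopin_charFun_bound` is false as stated** (the `r_f = diam(supp f)`
reading of Aizenman–Duminil-Copin 2021, Prop. 1.4, without the lower bound `r_f ≥ 1` that its
proof uses, §6.3, p. 26: "recall that by definition `r ≥ 1`"). Witness: the free DLR state at
`β_c` (a theorem of the tree), `L = 2`, the bump `f_ε = max(0, 1 - ‖·‖/ε)` of height `1`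
supported in `B(0, ε)`, `ε ≤ 1/2`, for which `adcField μ f_ε 2 = σ₀/Σ₂^{1/2}`, and
`z = ±2 Σ₂^{1/2}`: the two deviations `|e^{-2}(cosh 2 ± ⟨σ₀⟩ sinh 2) - 1|` add up to at least
`1 - e^{-4}`, while the claimed bound is `≤ C (2ε)¹² (2Σ₂^{1/2})⁴/(log 2)^c → 0` as `ε → 0`.
The corrected form (box radius `r ≥ 1`) is the tree's
`Literature.Probability.LatticeModels.aizenmanDuminilCopin_mgf_normalizedField_bound(_abs)`.
[cite: AizenmanDuminilCopinAnnals2021, Prop. 1.4 (p. 6) versus its proof §6.3 (p. 26, "by definition r ≥ 1")] -/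
theorem not_aizenmanDuminilCopin_charFun_bound : ¬ aizenmanDuminilCopin_charFun_bound := by
  classical
  rintro ⟨c, C, hc, hC, H⟩
  -- the free DLR state at `β_c`: a probability measure with non-negative pair correlations
  have hβ : 0 ≤ criticalBeta 4 := criticalBeta_nonneg 4
  obtain ⟨μ, hμG, -, hcorr⟩ := exists_freeMeasure_holds 4 0 hβ le_rfl
  haveI : IsProbabilityMeasure μ := ((mem_isingGibbsMeasures_iff _ _ _ _).1 hμG).isProbabilityMeasure
  have hpair : ∀ x y : (Literature.Probability.LatticeModels.Site 4), x ≠ y → 0 ≤ ∫ σ, spinAt x σ * spinAt y σ ∂μ := by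
    intro x y hxy
    have : (∫ σ, spinAt x σ * spinAt y σ ∂μ) = spinCorr μ {x, y} := by
      simp only [spinCorr, spinProduct, Finset.prod_pair hxy]
    rw [this, hcorr]
    exact freeCorr_nonneg hβ le_rfl _
  -- the block variance at `L = 2` and its square root
  set V : ℝ := boxSpinVariance μ 2 with hV
  have hVpos : 0 < V := one_pos.trans_le (one_le_boxSpinVariance μ hpair 2)
  set s : ℝ := Real.sqrt V with hs
  have hspos : 0 < s := Real.sqrt_pos.mpr hVpos
  -- the constant of the claimed bound at `z = ±2s`, `‖f‖ ≤ 1`, `diam ≤ 2ε ≤ 1`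
  set K : ℝ := C * (2 : ℝ) ^ 12 * (2 * s) ^ 4 / Real.log 2 ^ c with hK
  have hlog : 0 < Real.log 2 ^ c := Real.rpow_pos_of_pos (Real.log_pos one_lt_two) c
  have hKpos : 0 < K := by positivity
  -- the radius
  set ε : ℝ := min (1 / 2) (1 / (8 * K)) with hε
  have hεpos : 0 < ε := lt_min (by norm_num) (by positivity)
  have hεhalf : ε ≤ 1 / 2 := min_le_left _ _
  have hεK : ε ≤ 1 / (8 * K) := min_le_right _ _
  have hε1 : ε ≤ 1 := hεhalf.trans (by norm_num)
  -- the test function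
  set f : EuclideanSpace ℝ (Fin 4) → ℝ := fun y => max 0 (1 - ‖y‖ / ε) with hf
  have hf_cont : Continuous f :=
    continuous_const.max (continuous_const.sub (continuous_norm.div_const _))
  have hf_nonneg : ∀ y, 0 ≤ f y := fun y => le_max_left _ _
  have hf_le_one : ∀ y, f y ≤ 1 := fun y =>
    max_le zero_le_one (sub_le_self _ (div_nonneg (norm_nonneg _) hεpos.le))
  have hf_zero : ∀ y, ε ≤ ‖y‖ → f y = 0 := fun y hy => by
    have : 1 - ‖y‖ / ε ≤ 0 := by
      rw [sub_nonpos, le_div_iff₀ hεpos, one_mul]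
      exact hy
    exact max_eq_left this
  have hf_supp : Function.support f ⊆ Metric.closedBall 0 ε := by
    intro y hy
    rw [Metric.mem_closedBall, dist_zero_right]
    by_contra h
    exact hy (hf_zero y (le_of_not_ge h))
  have hf_tsupp : tsupport f ⊆ Metric.closedBall 0 ε :=
    closure_minimal hf_supp Metric.isClosed_closedBall
  have hf_cpt : HasCompactSupport f :=
    HasCompactSupport.of_support_subset_isCompact (isCompact_closedBall 0 ε) hf_supp
  have hf_sup : (⨆ y, |f y|) ≤ 1 := ciSup_le fun y => by
    rw [abs_of_nonneg (hf_nonneg y)]; exact hf_le_one y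
  have hf_sup0 : 0 ≤ ⨆ y, |f y| := Real.iSup_nonneg fun y => abs_nonneg _
  have hf_diam : Metric.diam (tsupport f) ≤ 2 * ε :=
    (Metric.diam_mono hf_tsupp Metric.isBounded_closedBall).trans (Metric.diam_closedBall hεpos.le)
  have hf0 : f 0 = 1 := by simp [hf]
  -- only the origin contributes to the lattice sum at `L = 2`
  have harg0 : (WithLp.toLp 2 fun i => ((0 : (Literature.Probability.LatticeModels.Site 4)) i : ℝ) / ((2 : ℕ) : ℝ) :
      EuclideanSpace ℝ (Fin 4)) = 0 := by
    ext i; simp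
  have hsum : ∀ σ : SpinConfig (Literature.Probability.LatticeModels.Site 4), smearedSpin f 2 σ = spinAt 0 σ := by
    intro σ
    unfold smearedSpin
    rw [tsum_eq_single 0]
    · rw [harg0, hf0, one_mul]
    · intro x hx
      rw [hf_zero _ ?_, zero_mul]
      calc ε ≤ 1 / 2 := hεhalf
        _ = ((2 : ℕ) : ℝ)⁻¹ := by norm_num
        _ ≤ _ := inv_le_norm_toLp_div hx (by norm_num)
  have hT : ∀ σ : SpinConfig (Literature.Probability.LatticeModels.Site 4), adcField μ f 2 σ = s⁻¹ * spinAt 0 σ := by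
    intro σ
    rw [adcField, hsum σ]
  -- the inner expectation `⟨T²⟩ = 1/s²`
  have hT2 : (∫ τ, adcField μ f 2 τ ^ 2 ∂μ) = (s ^ 2)⁻¹ := by
    have : (fun τ => adcField μ f 2 τ ^ 2) = fun _ => (s ^ 2)⁻¹ := by
      funext τ
      rw [hT τ, mul_pow, spinAt_sq, mul_one, inv_pow]
    rw [this, integral_const, smul_eq_mul, probReal_univ, one_mul]
  -- the moment generating function at `z = ±2s`
  set m : ℝ := ∫ σ, spinAt (0 : (Literature.Probability.LatticeModels.Site 4)) σ ∂μ with hm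
  have hint : Integrable (fun σ : SpinConfig (Literature.Probability.LatticeModels.Site 4) => spinAt (0 : (Literature.Probability.LatticeModels.Site 4)) σ) μ :=
    Integrable.of_bound (measurable_spinAt 0).aestronglyMeasurable 1
      (Eventually.of_forall fun σ => by rw [Real.norm_eq_abs, abs_spinAt])
  have hMGF : ∀ η : ℝ, (η = 1 ∨ η = -1) →
      (∫ σ, Real.exp (η * (2 * s) * adcField μ f 2 σ -
          (η * (2 * s)) ^ 2 / 2 * ∫ τ, adcField μ f 2 τ ^ 2 ∂μ) ∂μ) =
        (1 + Real.exp (-4)) / 2 + η * ((1 - Real.exp (-4)) / 2) * m := by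
    intro η hη
    rw [hT2]
    have key : ∀ t : ℝ, (t = 1 ∨ t = -1) →
        Real.exp (2 * t - 2) = (1 + Real.exp (-4)) / 2 + (1 - Real.exp (-4)) / 2 * t := by
      intro t ht
      rcases ht with rfl | rfl
      · rw [show (2 : ℝ) * 1 - 2 = 0 by norm_num, Real.exp_zero]; ring
      · rw [show (2 : ℝ) * (-1) - 2 = -4 by norm_num]; ring
    have hptw : ∀ σ : SpinConfig (Literature.Probability.LatticeModels.Site 4),
        Real.exp (η * (2 * s) * adcField μ f 2 σ - (η * (2 * s)) ^ 2 / 2 * (s ^ 2)⁻¹) =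
          (1 + Real.exp (-4)) / 2 + η * ((1 - Real.exp (-4)) / 2) * spinAt 0 σ := by
      intro σ
      rw [hT σ]
      have hexp : η * (2 * s) * (s⁻¹ * spinAt 0 σ) - (η * (2 * s)) ^ 2 / 2 * (s ^ 2)⁻¹ =
          2 * (η * spinAt 0 σ) - 2 := by
        have hss : s * s⁻¹ = 1 := mul_inv_cancel₀ hspos.ne'
        have hη2 : η ^ 2 = 1 := by rcases hη with rfl | rfl <;> norm_num
        calc η * (2 * s) * (s⁻¹ * spinAt 0 σ) - (η * (2 * s)) ^ 2 / 2 * (s ^ 2)⁻¹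
            = 2 * (η * spinAt 0 σ) * (s * s⁻¹) - 2 * η ^ 2 * (s * s⁻¹) ^ 2 := by ring
          _ = 2 * (η * spinAt 0 σ) - 2 := by rw [hss, hη2]; ring
      rw [hexp]
      have hprod : η * spinAt 0 σ = 1 ∨ η * spinAt 0 σ = -1 := by
        rcases hη with rfl | rfl <;> rcases spinAt_eq_one_or_eq_neg_one (0 : (Literature.Probability.LatticeModels.Site 4)) σ with h | h <;>
          simp [h]
      rw [key _ hprod]
      ring
    simp_rw [hptw]
    rw [integral_add (integrable_const _) (hint.const_mul _), integral_const, smul_eq_mul,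
      probReal_univ, one_mul, integral_const_mul]
  -- the two instances of the claimed bound
  have hR : ∀ η : ℝ, (η = 1 ∨ η = -1) →
      |(∫ σ, Real.exp (η * (2 * s) * adcField μ f 2 σ -
          (η * (2 * s)) ^ 2 / 2 * ∫ τ, adcField μ f 2 τ ^ 2 ∂μ) ∂μ) - 1| ≤ K * ε := by
    intro η hη
    have hη4 : (η * (2 * s)) ^ 4 = (2 * s) ^ 4 := by
      rcases hη with rfl | rfl <;> ring
    have h := H μ hμG 2 le_rfl f hf_cont hf_cpt (η * (2 * s))
    rw [hη4] at h
    refine h.trans ?_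
    have hdiam0 : 0 ≤ Metric.diam (tsupport f) := Metric.diam_nonneg
    have hlog2 : Real.log ((2 : ℕ) : ℝ) ^ c = Real.log 2 ^ c := by norm_num
    rw [hlog2]
    calc C * (⨆ y, |f y|) ^ 4 * Metric.diam (tsupport f) ^ 12 * (2 * s) ^ 4 / Real.log 2 ^ c
        ≤ C * 1 ^ 4 * (2 * ε) ^ 12 * (2 * s) ^ 4 / Real.log 2 ^ c := by gcongr
      _ = K * ε ^ 12 := by rw [hK]; ring
      _ ≤ K * ε := by
          gcongr
          calc ε ^ 12 ≤ ε ^ 1 := pow_le_pow_of_le_one hεpos.le hε1 (by norm_num)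
            _ = ε := pow_one ε
  -- contradiction: the two deviations add up to `1 - e^{-4} > 1/2`, but `2Kε ≤ 1/4`
  have hplus := hR 1 (Or.inl rfl)
  have hminus := hR (-1) (Or.inr rfl)
  rw [hMGF 1 (Or.inl rfl)] at hplus
  rw [hMGF (-1) (Or.inr rfl)] at hminus
  have hsum2 : 1 - Real.exp (-4) ≤ 2 * (K * ε) := by
    have := (abs_add_le _ _).trans (add_le_add hplus hminus)
    have e4 : ((1 + Real.exp (-4)) / 2 + 1 * ((1 - Real.exp (-4)) / 2) * m - 1) +
        ((1 + Real.exp (-4)) / 2 + -1 * ((1 - Real.exp (-4)) / 2) * m - 1) =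
        -(1 - Real.exp (-4)) := by ring
    rw [e4, abs_neg, abs_of_nonneg (sub_nonneg.mpr (Real.exp_le_one_iff.mpr (by norm_num)))]
      at this
    linarith
  have hexp4 : Real.exp (-4) ≤ 1 / 2 := by
    have h5 : (5 : ℝ) ≤ Real.exp 4 := by
      have := Real.add_one_le_exp (4 : ℝ)
      linarith
    rw [Real.exp_neg, inv_le_comm₀ (Real.exp_pos 4) (by norm_num)]
    linarith
  have hKε : K * ε ≤ 1 / 8 := by
    calc K * ε ≤ K * (1 / (8 * K)) := by gcongr
      _ = 1 / 8 := by field_simp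
  linarith

/-! ### The corrected statement in the vocabulary of `Sweep1`, as a proved reduction

`adcField μ f L` (`Sweep1`: a `tsum`, `Σ_L = ∑_{x,y ∈ Λ_L} ⟨σ_xσ_y⟩_μ`) is the normalised field
`normalizedField μ L f` of `HighDimTriviality` (a `finsum`, `Σ_L = ⟨(∑_{x ∈ Λ_L} σ_x)²⟩_μ`) for
natural `L ≥ 1` and `f` vanishing outside a cube, so the tree's DLR-state facts
`aizenmanDuminilCopin_mgf_normalizedField_bound` (the display of Prop. 1.4 with the box radius
`r ≥ 1` of its proof) and `aizenmanDuminilCopin_mgf_normalizedField_bound_abs` (the form the proof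
establishes) give the corrected versions of `aizenmanDuminilCopin_charFun_bound` below. No new
named fact is introduced. -/

/-- The rescaled site `x/L ∈ ℝ^d` of `Sweep1` is `L⁻¹ • siteVec x`. [folklore] -/
theorem toLp_div_eq_smul_siteVec {d : ℕ} (x : Literature.Probability.LatticeModels.Site d) (L : ℝ) :
    (WithLp.toLp 2 fun i => (x i : ℝ) / L : EuclideanSpace ℝ (Fin d)) = L⁻¹ • siteVec x := by
  ext i
  simp [div_eq_inv_mul]

/-- For `f` vanishing outside `[-r, r]^d` and `L ≠ 0`, the smeared spin of `Sweep1` is a finite sum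
over the box `Λ_{rL}`. [folklore] -/
theorem smearedSpin_eq_sum {d : ℕ} {f : EuclideanSpace ℝ (Fin d) → ℝ} {r : ℝ}
    (hf : ∀ x, f x ≠ 0 → ∀ i, |x i| ≤ r) {L : ℕ} (hL : L ≠ 0)
    (σ : SpinConfig (Literature.Probability.LatticeModels.Site d)) :
    smearedSpin f L σ =
      ∑ x ∈ latticeBox d (r / |((L : ℝ))⁻¹|), f (((L : ℝ))⁻¹ • siteVec x) * spinAt x σ := by
  unfold smearedSpin
  simp_rw [toLp_div_eq_smul_siteVec _ (L : ℝ)]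
  refine tsum_eq_sum fun x hx => ?_
  by_contra hne
  have hfx : f (((L : ℝ))⁻¹ • siteVec x) ≠ 0 := fun h0 => hne (by rw [h0, zero_mul])
  refine hx (mem_latticeBox.mpr fun i => ?_)
  have h := hf _ hfx i
  rw [PiLp.smul_apply, siteVec_apply, smul_eq_mul, abs_mul] at h
  rw [le_div_iff₀ (abs_pos.mpr (inv_ne_zero (Nat.cast_ne_zero.mpr hL))), mul_comm]
  exact h

/-- `boxSpinVariance μ L` (`∑_{x,y ∈ Λ_L} ⟨σ_xσ_y⟩_μ`, `Sweep1`) is `blockSpinVariance μ L`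
(`⟨(∑_{x ∈ Λ_L} σ_x)²⟩_μ`, `HighDimTriviality`) for a finite measure. [folklore] -/
theorem boxSpinVariance_eq_blockSpinVariance {d : ℕ}
    (μ : Measure (SpinConfig (Literature.Probability.LatticeModels.Site d))) [IsFiniteMeasure μ] (L : ℕ) :
    boxSpinVariance μ L = blockSpinVariance μ (L : ℝ) := by
  have hB : latticeBox d (L : ℝ) = box d L := by
    rw [latticeBox_eq_box (Nat.cast_nonneg L), Nat.floor_natCast]
  rw [blockSpinVariance_eq_sqMoment μ subset_rfl, sqMoment_eq_sum, hB]
  unfold boxSpinVariance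
  refine Finset.sum_congr rfl fun x hx => Finset.sum_congr rfl fun y hy => ?_
  rw [if_pos hx, if_pos hy, one_mul, one_mul]

/-- `adcField μ f L = normalizedField μ L f` for natural `L ≠ 0`, a finite measure `μ` and `f`
vanishing outside a cube (Aizenman–Duminil-Copin 2021, (1.4): both are
`T_{f,L} = Σ_L^{-1/2} ∑_x f(x/L) σ_x`). [cite: AizenmanDuminilCopinAnnals2021, §1.2 (1.4)] -/
theorem adcField_eq_normalizedField {d : ℕ}
    (μ : Measure (SpinConfig (Literature.Probability.LatticeModels.Site d))) [IsFiniteMeasure μ]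
    {f : EuclideanSpace ℝ (Fin d) → ℝ} {r : ℝ} (hf : ∀ x, f x ≠ 0 → ∀ i, |x i| ≤ r)
    {L : ℕ} (hL : L ≠ 0) (σ : SpinConfig (Literature.Probability.LatticeModels.Site d)) :
    adcField μ f L σ = normalizedField μ (L : ℝ) f σ := by
  rw [adcField, normalizedField_eq_mul_sum μ (Nat.cast_ne_zero.mpr hL) hf, smearedSpin_eq_sum hf hL,
    boxSpinVariance_eq_blockSpinVariance]

/-- **Corrected `aizenmanDuminilCopin_charFun_bound`, printed display with the box radius of the
proof** (Aizenman–Duminil-Copin 2021, Prop. 1.4 at `β = β_c`, for `f ∈ C_0(ℝ⁴)` vanishing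
outside `[-r, r]⁴`, `r ≥ 1`, as in §6.3): granted the tree's named fact
`Literature.Probability.LatticeModels.aizenmanDuminilCopin_mgf_normalizedField_bound`, there are
`c, C > 0` with `|⟨exp[z T_{f,L} - (z²/2)⟨T_{f,L}²⟩]⟩_μ - 1| ≤ C ‖f‖_∞⁴ r¹² z⁴/(log L)^c` for every
critical DLR state `μ`, every `L ≥ 2`, such `f`, `r` and real `z`, with `T_{f,L} = adcField μ f L`.
(The caveat recorded on that fact for signed `f` applies verbatim.) A reduction, not a new fact.
[cite: AizenmanDuminilCopinAnnals2021, Prop. 1.4 (p. 6) with §6.3 (p. 26, r ≥ 1)] -/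
theorem aizenmanDuminilCopin_charFun_bound_boxRadius
    (h : aizenmanDuminilCopin_mgf_normalizedField_bound) :
    ∃ c C : ℝ, 0 < c ∧ 0 < C ∧ ∀ μ ∈ isingGibbsMeasures 4 (criticalBeta 4) 0, ∀ L : ℕ, 2 ≤ L →
      ∀ f : EuclideanSpace ℝ (Fin 4) → ℝ, Continuous f →
      ∀ r : ℝ, 1 ≤ r → (∀ x, f x ≠ 0 → ∀ i, |x i| ≤ r) → ∀ z : ℝ,
        |(∫ σ, Real.exp (z * adcField μ f L σ -
              z ^ 2 / 2 * ∫ τ, adcField μ f L τ ^ 2 ∂μ) ∂μ) - 1| ≤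
          C * (⨆ x, |f x|) ^ 4 * r ^ 12 * z ^ 4 / Real.log L ^ c := by
  obtain ⟨c, C, hc, hC, H⟩ := h
  refine ⟨c, C, hc, hC, fun μ hμ L hL f hf r hr hfr z => ?_⟩
  haveI : IsProbabilityMeasure μ := ((mem_isingGibbsMeasures_iff _ _ _ _).1 hμ).isProbabilityMeasure
  have hL0 : L ≠ 0 := by omega
  have hL1 : (1 : ℝ) < L := by exact_mod_cast (show 1 < L by omega)
  have key := H (criticalBeta 4) L r (criticalBeta_nonneg 4) le_rfl (Or.inl rfl) hL1 hr μ hμ f hf hfr z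
  simp_rw [adcField_eq_normalizedField μ hfr hL0]
  exact key

/-- **Corrected `aizenmanDuminilCopin_charFun_bound`, `f ≥ 0`, from the form the printed proof
establishes** (Aizenman–Duminil-Copin 2021, Prop. 1.4 at `β = β_c` as used on p. 6 for
non-negative test functions; §6.3): granted the tree's named fact
`Literature.Probability.LatticeModels.aizenmanDuminilCopin_mgf_normalizedField_bound_abs`, there
are `c, C > 0` with `|⟨exp[z T_{f,L} - (z²/2)⟨T_{f,L}²⟩]⟩_μ - 1| ≤ C ‖f‖_∞⁴ r¹² z⁴/(log L)^c` for
every critical DLR state `μ`, `L ≥ 2`, `f ≥ 0` continuous vanishing outside `[-r, r]⁴`, `r ≥ 1`,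
and real `z` (`T_{f,L} = adcField μ f L`). A reduction, not a new fact.
[cite: AizenmanDuminilCopinAnnals2021, Prop. 1.4 (p. 6) and its proof §6.3 (p. 26)] -/
theorem aizenmanDuminilCopin_charFun_bound_boxRadius_nonneg
    (h : aizenmanDuminilCopin_mgf_normalizedField_bound_abs) :
    ∃ c C : ℝ, 0 < c ∧ 0 < C ∧ ∀ μ ∈ isingGibbsMeasures 4 (criticalBeta 4) 0, ∀ L : ℕ, 2 ≤ L →
      ∀ f : EuclideanSpace ℝ (Fin 4) → ℝ, Continuous f → (∀ x, 0 ≤ f x) →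
      ∀ r : ℝ, 1 ≤ r → (∀ x, f x ≠ 0 → ∀ i, |x i| ≤ r) → ∀ z : ℝ,
        |(∫ σ, Real.exp (z * adcField μ f L σ -
              z ^ 2 / 2 * ∫ τ, adcField μ f L τ ^ 2 ∂μ) ∂μ) - 1| ≤
          C * (⨆ x, |f x|) ^ 4 * r ^ 12 * z ^ 4 / Real.log L ^ c := by
  obtain ⟨c, C, hc, hC, H⟩ := h.of_nonneg
  refine ⟨c, C, hc, hC, fun μ hμ L hL f hf hf0 r hr hfr z => ?_⟩
  haveI : IsProbabilityMeasure μ := ((mem_isingGibbsMeasures_iff _ _ _ _).1 hμ).isProbabilityMeasure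
  have hL0 : L ≠ 0 := by omega
  have hL1 : (1 : ℝ) < L := by exact_mod_cast (show 1 < L by omega)
  have key := H (criticalBeta 4) L r (criticalBeta_nonneg 4) le_rfl (Or.inl rfl) hL1 hr μ hμ f hf hfr hf0 z
  simp_rw [adcField_eq_normalizedField μ hfr hL0]
  exact key

/-! ### Small helpers of record

The following six lemmas were landed in this file by proposals p27925/p28453 (unit
`…QuantumFi-551125c82b`, working on `aizenmanDuminilCopin_gaussian_limit`) and were removed by the
whole-file proposal p27934 of this unit (both units created the new sibling file
`Sweep1TrivialityProofs.lean` within minutes of each other; the gate recorded "removes 10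
declaration(s) nothing references"). They are restored here with the signatures recorded by the
ledger (proofs rewritten). -/

/-- A non-zero lattice site has Euclidean norm at least `1`. [folklore] -/
theorem one_le_norm_siteVec_of_ne_zero {d : ℕ} {x : Literature.Probability.LatticeModels.Site d}
    (hx : x ≠ 0) : 1 ≤ ‖siteVec x‖ := by
  have h := inv_le_norm_toLp_div hx one_pos
  rw [inv_one, toLp_div_eq_smul_siteVec, inv_one, one_smul] at h
  exact h

/-- The rescaled site `x/L` of `Sweep1` (natural `L`) is `L⁻¹ • siteVec x`. [folklore] -/
theorem toLp_div_natCast_eq_smul_siteVec {d : ℕ} (x : Literature.Probability.LatticeModels.Site d)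
    (L : ℕ) :
    (WithLp.toLp 2 fun i => (x i : ℝ) / L : EuclideanSpace ℝ (Fin d)) = (L : ℝ)⁻¹ • siteVec x :=
  toLp_div_eq_smul_siteVec x L

/-- For `f` vanishing outside `[-r, r]^d` and natural `L ≠ 0`, the summand `f(x/L) σ_x` vanishes
off the box `Λ_{rL}`. [folklore] -/
theorem support_smear_subset_latticeBox {d : ℕ} {f : EuclideanSpace ℝ (Fin d) → ℝ} {r : ℝ}
    {L : ℕ} (hL : L ≠ 0) (hf : ∀ x, f x ≠ 0 → ∀ i, |x i| ≤ r)
    (σ : SpinConfig (Literature.Probability.LatticeModels.Site d)) :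
    (Function.support fun x : Literature.Probability.LatticeModels.Site d =>
        f ((L : ℝ)⁻¹ • siteVec x) * spinAt x σ) ⊆ ↑(latticeBox d (r / |(L : ℝ)⁻¹|)) := by
  intro x hx
  rw [Function.mem_support] at hx
  have hfx : f ((L : ℝ)⁻¹ • siteVec x) ≠ 0 := fun h0 => hx (by rw [h0, zero_mul])
  refine Finset.mem_coe.mpr (mem_latticeBox.mpr fun i => ?_)
  have h := hf _ hfx i
  rw [PiLp.smul_apply, siteVec_apply, smul_eq_mul, abs_mul] at h
  rw [le_div_iff₀ (abs_pos.mpr (inv_ne_zero (Nat.cast_ne_zero.mpr hL))), mul_comm]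
  exact h

/-- If `f(x/L) = 0` for every non-zero site `x`, the smeared spin of `Sweep1` is `f(0) σ₀`
(single-site test functions). [folklore] -/
theorem smearedSpin_eq_of_forall_ne_zero {d : ℕ} {f : EuclideanSpace ℝ (Fin d) → ℝ} {L : ℕ}
    (hf : ∀ x : Literature.Probability.LatticeModels.Site d, x ≠ 0 →
      f (WithLp.toLp 2 fun i => (x i : ℝ) / L) = 0)
    (σ : SpinConfig (Literature.Probability.LatticeModels.Site d)) :
    smearedSpin f L σ = f 0 * spinAt 0 σ := by
  unfold smearedSpin
  rw [tsum_eq_single 0 fun x hx => by rw [hf x hx, zero_mul]]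
  have h0 : (WithLp.toLp 2 fun i => ((0 : Literature.Probability.LatticeModels.Site d) i : ℝ) / (L : ℝ) :
      EuclideanSpace ℝ (Fin d)) = 0 := by
    ext i; simp
  rw [h0]

/-- `e^{2σ_x - 2} + e^{-2σ_x - 2} = 1 + e^{-4}` for an Ising spin `σ_x = ±1`. [folklore] -/
theorem exp_two_spin_add {d : ℕ} (x : Literature.Probability.LatticeModels.Site d)
    (σ : SpinConfig (Literature.Probability.LatticeModels.Site d)) :
    Real.exp (2 * spinAt x σ - 2) + Real.exp (-(2 * spinAt x σ) - 2) = 1 + Real.exp (-4) := by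
  rcases spinAt_eq_one_or_eq_neg_one x σ with h | h <;> rw [h] <;> norm_num [add_comm]

/-- Exponential moments of the (bounded) normalised field `T_{f,L}` exist under any finite
measure (`L ≠ 0`, `f` vanishing outside a cube). [folklore] -/
theorem integrable_exp_mul_normalizedField {d : ℕ}
    (μ : Measure (SpinConfig (Literature.Probability.LatticeModels.Site d))) [IsFiniteMeasure μ]
    {f : EuclideanSpace ℝ (Fin d) → ℝ} {r L : ℝ} (hL : L ≠ 0)
    (hf : ∀ x, f x ≠ 0 → ∀ i, |x i| ≤ r) (z : ℝ) :
    Integrable (fun σ => Real.exp (z * normalizedField μ L f σ)) μ := by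
  simp_rw [normalizedField_eq_smearedSpin μ hL f]
  exact integrable_exp_mul_smearedSpin μ _ (inv_ne_zero hL) hf z

/-! ### `aizenmanDuminilCopin_gaussian_limit` reduced to the tree's facts

Restored content of p27925/p28453 (see above), with the recorded signatures: the `Sweep1` fact
`aizenmanDuminilCopin_gaussian_limit` (every subsequential weak limit of the law of `T_{f,L_k}`
under a critical DLR state is a centred Gaussian) follows from ADC Prop. 1.4 in the form its
proof establishes (`aizenmanDuminilCopin_mgf_normalizedField_bound_abs`) together with an upper
bound on `⟨T_{g,L}²⟩` (`g = f, |f|`), by the argument printed after Prop. 1.4 (p. 6) made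
quantitative in `HighDimTriviality`, Part II: the exponential moments `M_k(z) = ⟨e^{z T_k}⟩`
satisfy `M_k(z) e^{-z²⟨T_k²⟩/2} → 1` and are uniformly bounded, weak convergence upgrades to
convergence of `M_k(z)` (`tendsto_integral_of_tendsto_of_sq_le`), the limit is `e^{v z²/2}`
(`exists_variance_of_tendsto_mgf`) and a law with this moment generating function is `N(0, v)`
(`eq_gaussianReal_of_mgf_eq`). The variance bound is supplied either by the named fact
`normalizedField_variance_bounds` (`…_of_bounds`) or by uniqueness of the critical state
(`…_of_bound_abs_of_unique`: the unique state is the translation-invariant free state with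
non-negative pair correlations, `integral_normalizedField_sq_le`); since uniqueness at `β_c` is
a theorem of the tree (`hasUniqueGibbsMeasure_criticalBeta_holds`), the `Sweep1` fact is reduced
to the single named fact `aizenmanDuminilCopin_mgf_normalizedField_bound_abs`
(`aizenmanDuminilCopin_gaussian_limit_of_bound_abs`). -/

/-- **Structure of the critical state under uniqueness**: if `|𝒢(β_c, 0)| = 1` (`d ≥ 3`), every
`μ ∈ 𝒢(β_c, 0)` is translation invariant with non-negative pair correlations — it is the free
state of `exists_freeMeasure_holds` (Friedli–Velenik 2017, Exercise 3.16: translation invariance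
of `⟨·⟩^∅`; Thm. 3.20: GKS I). [cite: FriedliVelenik2017, Exercise 3.16 and Thm. 3.20] -/
theorem isingGibbsMeasure_criticalBeta_structure {d : ℕ}
    (hU : hasUniqueGibbsMeasure_criticalBeta (d := d)) (hd : 3 ≤ d)
    {μ : Measure (SpinConfig (Literature.Probability.LatticeModels.Site d))}
    (hμ : μ ∈ isingGibbsMeasures d (criticalBeta d) 0) :
    IsTranslationInvariantMeasure μ ∧
      ∀ x y : Literature.Probability.LatticeModels.Site d, 0 ≤ ∫ σ, spinAt x σ * spinAt y σ ∂μ := by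
  have hβ : 0 ≤ criticalBeta d := criticalBeta_nonneg d
  haveI : IsProbabilityMeasure μ := ((mem_isingGibbsMeasures_iff _ _ _ _).1 hμ).isProbabilityMeasure
  obtain ⟨μf, hμf, -, hcorrf⟩ := exists_freeMeasure_holds d 0 hβ le_rfl
  have hcorr : ∀ A, spinCorr μ A = freeCorr d (criticalBeta d) 0 A := fun A => by
    rw [(hU hd).1 hμ hμf]
    exact hcorrf A
  refine ⟨isTranslationInvariantMeasure_of_spinCorr_eq_freeCorr hβ le_rfl μ hcorr, fun x y => ?_⟩
  by_cases hxy : x = y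
  · subst hxy; simp
  · have : (∫ σ, spinAt x σ * spinAt y σ ∂μ) = spinCorr μ {x, y} := by
      simp only [spinCorr, spinProduct, Finset.prod_pair hxy]
    rw [this, hcorr]
    exact freeCorr_nonneg hβ le_rfl _

/-- **`aizenmanDuminilCopin_gaussian_limit` from ADC Prop. 1.4 (proof form) and an upper variance
bound** (Aizenman–Duminil-Copin 2021, the Gaussianity corollary printed after Prop. 1.4, p. 6,
and Thm. 1.2 for the critical Ising case): if `aizenmanDuminilCopin_mgf_normalizedField_bound_abs`
holds and `⟨T_{g,L}²⟩_μ ≤ C_g` for every critical DLR state `μ`, every `g ∈ C_0(ℝ⁴)` and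
`L ≥ 1`, then every subsequential weak limit `ν` of the law of `T_{f,L_k} = adcField μ f L_k` is a
centred Gaussian. [cite: AizenmanDuminilCopinAnnals2021, arXiv:1912.07973 Prop. 1.4 and p. 6; Thm 1.2 (p. 4) with p. 5] -/
theorem aizenmanDuminilCopin_gaussian_limit_of_bound_abs_of_variance
    (h₁ : aizenmanDuminilCopin_mgf_normalizedField_bound_abs)
    (hvar : ∀ μ ∈ isingGibbsMeasures 4 (criticalBeta 4) 0, ∀ g : EuclideanSpace ℝ (Fin 4) → ℝ,
      Continuous g → HasCompactSupport g →
      ∃ C : ℝ, ∀ L : ℝ, 1 ≤ L → ∫ σ, normalizedField μ L g σ ^ 2 ∂μ ≤ C) :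
    aizenmanDuminilCopin_gaussian_limit := by
  intro μ hμ f hf hfc L hL ν hν hlim
  haveI : IsProbabilityMeasure μ := ((mem_isingGibbsMeasures_iff _ _ _ _).1 hμ).isProbabilityMeasure
  have hβ : 0 ≤ criticalBeta 4 := criticalBeta_nonneg 4
  obtain ⟨r, hr1, hfr⟩ := exists_cube_of_hasCompactSupport f hfc
  obtain ⟨Cf, hCf⟩ := hvar μ hμ f hf hfc
  obtain ⟨Ca, hCa⟩ := hvar μ hμ (fun x => |f x|) hf.abs (hfc.comp_left abs_zero)
  -- the shifted scales `L (k+1) ≥ 1`, tending to infinity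
  have hLk : ∀ k, 1 ≤ L (k + 1) := fun k => (Nat.succ_le_succ (Nat.zero_le k)).trans (hL.id_le _)
  have hL0 : ∀ k, L (k + 1) ≠ 0 := fun k => Nat.one_le_iff_ne_zero.mp (hLk k)
  have hL1 : ∀ k, (1 : ℝ) ≤ (L (k + 1) : ℝ) := fun k => by exact_mod_cast hLk k
  have hLtop : Tendsto (fun k => ((L (k + 1) : ℕ) : ℝ)) atTop atTop :=
    tendsto_natCast_atTop_atTop.comp (hL.tendsto_atTop.comp (tendsto_add_atTop_nat 1))
  -- the fields `T_k = adcField μ f (L (k+1)) = normalizedField μ (L (k+1)) f`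
  set T : ℕ → SpinConfig (Literature.Probability.LatticeModels.Site 4) → ℝ :=
    fun k σ => normalizedField μ (L (k + 1) : ℝ) f σ with hT_def
  have hT : ∀ k σ, adcField μ f (L (k + 1)) σ = T k σ := fun k σ =>
    adcField_eq_normalizedField μ hfr (hL0 k) σ
  have hX : ∀ k, AEMeasurable (T k) μ := fun k =>
    (measurable_normalizedField μ (Nat.cast_ne_zero.mpr (hL0 k)) hfr).aemeasurable
  have hVle : ∀ k, ∫ σ, T k σ ^ 2 ∂μ ≤ Cf := fun k => hCf _ (hL1 k)
  have hWle : ∀ k, ∫ σ, normalizedField μ (L (k + 1) : ℝ) (fun x => |f x|) σ ^ 2 ∂μ ≤ Ca :=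
    fun k => hCa _ (hL1 k)
  -- Step 1: `M_k(z) e^{-z² V_k/2} - 1 → 0` from ADC Prop. 1.4 (proof form)
  have hcore : ∀ z : ℝ, Tendsto (fun k =>
      (∫ σ, Real.exp (z * T k σ) ∂μ) * Real.exp (-(z ^ 2 * (∫ σ, T k σ ^ 2 ∂μ) / 2)) - 1)
      atTop (𝓝 0) := by
    intro z
    obtain ⟨c, C, hc, hC, H⟩ := h₁
    have hu : Tendsto (fun k => (Real.log ((L (k + 1) : ℕ) : ℝ) ^ c)⁻¹) atTop (𝓝 0) :=
      tendsto_inv_atTop_zero.comp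
        ((tendsto_rpow_atTop hc).comp (Real.tendsto_log_atTop.comp hLtop))
    have hev : ∀ᶠ k in atTop, (1 : ℝ) < ((L (k + 1) : ℕ) : ℝ) := hLtop.eventually (eventually_gt_atTop 1)
    refine squeeze_zero_norm' (a := fun k =>
      (Real.exp (z ^ 2 / 2 * Ca) * (C * (⨆ x, |f x|) ^ 4 * r ^ 12 * z ^ 4)) *
        (Real.log ((L (k + 1) : ℕ) : ℝ) ^ c)⁻¹)
      (hev.mono fun k hk => ?_) (by simpa using tendsto_const_nhds.mul hu)
    have hest := H (criticalBeta 4) (L (k + 1)) r hβ le_rfl (Or.inl rfl) hk hr1 μ hμ f hf hfr z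
    set s : ℝ := z ^ 2 / 2 * ∫ σ, T k σ ^ 2 ∂μ with hs_def
    have hs : z ^ 2 * (∫ σ, T k σ ^ 2 ∂μ) / 2 = s := by rw [hs_def]; ring
    have hs0 : 0 ≤ s := mul_nonneg (by positivity) (integral_nonneg fun σ => sq_nonneg _)
    have hkey : ∀ M : ℝ, |M * Real.exp (-s) - 1| ≤ |M - Real.exp s| := by
      intro M
      have h1 : M * Real.exp (-s) - 1 = Real.exp (-s) * (M - Real.exp s) := by
        rw [mul_sub, Real.exp_neg, ← mul_comm M, inv_mul_cancel₀ (Real.exp_pos s).ne']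
      rw [h1, abs_mul, Real.abs_exp]
      exact mul_le_of_le_one_left (abs_nonneg _) (Real.exp_le_one_iff.mpr (neg_nonpos.mpr hs0))
    have hlogpos : 0 < Real.log ((L (k + 1) : ℕ) : ℝ) ^ c := Real.rpow_pos_of_pos (Real.log_pos hk) c
    rw [Real.norm_eq_abs, hs]
    refine (hkey _).trans ?_
    calc |(∫ σ, Real.exp (z * T k σ) ∂μ) - Real.exp s|
        ≤ Real.exp (z ^ 2 / 2 * ∫ σ, normalizedField μ (L (k + 1) : ℝ) (fun x => |f x|) σ ^ 2 ∂μ) *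
            (C * (⨆ x, |f x|) ^ 4 * r ^ 12 * z ^ 4 / Real.log ((L (k + 1) : ℕ) : ℝ) ^ c) := hest
      _ ≤ Real.exp (z ^ 2 / 2 * Ca) *
            (C * (⨆ x, |f x|) ^ 4 * r ^ 12 * z ^ 4 / Real.log ((L (k + 1) : ℕ) : ℝ) ^ c) := by
          have h0 : 0 ≤ C * (⨆ x, |f x|) ^ 4 * r ^ 12 * z ^ 4 / Real.log ((L (k + 1) : ℕ) : ℝ) ^ c := by
            have := iSup_abs_nonneg f
            have hr0 : 0 ≤ r := zero_le_one.trans hr1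
            positivity
          gcongr
          exact hWle k
      _ = (Real.exp (z ^ 2 / 2 * Ca) * (C * (⨆ x, |f x|) ^ 4 * r ^ 12 * z ^ 4)) *
            (Real.log ((L (k + 1) : ℕ) : ℝ) ^ c)⁻¹ := by ring
  -- Step 2: uniformly bounded exponential moments, eventually `M_k(z) ≤ 2 e^{z² Cf/2}`
  have hbound : ∀ z : ℝ, ∀ᶠ k in atTop,
      (∫ σ, Real.exp (z * T k σ) ∂μ) ≤ 2 * Real.exp (z ^ 2 * Cf / 2) := by
    intro z
    have h2 : ∀ᶠ k in atTop, (∫ σ, Real.exp (z * T k σ) ∂μ) *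
        Real.exp (-(z ^ 2 * (∫ σ, T k σ ^ 2 ∂μ) / 2)) - 1 < 1 :=
      (hcore z).eventually (gt_mem_nhds one_pos)
    filter_upwards [h2] with k hk
    have hlt : (∫ σ, Real.exp (z * T k σ) ∂μ) *
        Real.exp (-(z ^ 2 * (∫ σ, T k σ ^ 2 ∂μ) / 2)) < 2 := by linarith
    rw [Real.exp_neg, ← div_eq_mul_inv, div_lt_iff₀ (Real.exp_pos _)] at hlt
    refine hlt.le.trans ?_
    have := hVle k
    gcongr
  -- Step 3: laws and weak convergence (from `hlim`, along the shifted sequence)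
  let νk : ℕ → ProbabilityMeasure ℝ := fun k =>
    ⟨μ.map (T k), Measure.isProbabilityMeasure_map (hX k)⟩
  let ν₀ : ProbabilityMeasure ℝ := ⟨ν, hν⟩
  have hmap : ∀ k (F : ℝ → ℝ), Continuous F →
      ∫ x, F x ∂(νk k : Measure ℝ) = ∫ σ, F (T k σ) ∂μ := fun k F hF => by
    simp only [νk, ProbabilityMeasure.coe_mk]
    exact integral_map (hX k) hF.aestronglyMeasurable
  have hνk : Tendsto νk atTop (𝓝 ν₀) := by
    refine ProbabilityMeasure.tendsto_iff_forall_integral_tendsto.mpr fun g => ?_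
    have h := (hlim g g.continuous g.isBounded_range).comp (tendsto_add_atTop_nat 1)
    simp only [ν₀, ProbabilityMeasure.coe_mk]
    refine (h.congr fun k => ?_)
    simp only [Function.comp_apply, hT, hmap k g g.continuous]
  -- Step 4: `M_k(z) → ∫ e^{zx} dν(x)`, finite
  have hlimit : ∀ z : ℝ, Integrable (fun x => Real.exp (z * x)) ν ∧
      Tendsto (fun k => ∫ σ, Real.exp (z * T k σ) ∂μ) atTop (𝓝 (∫ x, Real.exp (z * x) ∂ν)) := by
    intro z
    have hsq : ∀ x : ℝ, Real.exp (z * x) ^ 2 = Real.exp (2 * z * x) := fun x => by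
      rw [sq, ← Real.exp_add]
      ring_nf
    have hB : ∀ᶠ k in atTop, Integrable (fun x => Real.exp (z * x) ^ 2) (νk k : Measure ℝ) ∧
        ∫ x, Real.exp (z * x) ^ 2 ∂(νk k : Measure ℝ) ≤ 2 * Real.exp ((2 * z) ^ 2 * Cf / 2) := by
      filter_upwards [hbound (2 * z)] with k hk
      simp_rw [hsq]
      refine ⟨?_, ?_⟩
      · simp only [νk, ProbabilityMeasure.coe_mk]
        refine (integrable_map_measure (by fun_prop) (hX k)).mpr ?_
        exact integrable_exp_mul_normalizedField μ (Nat.cast_ne_zero.mpr (hL0 k)) hfr (2 * z)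
      · rw [hmap k _ (by fun_prop)]
        exact hk
    have h := tendsto_integral_of_tendsto_of_sq_le hνk (by fun_prop) (fun x => (Real.exp_pos _).le) hB
    simp only [ν₀, ProbabilityMeasure.coe_mk] at h
    refine ⟨h.1, ?_⟩
    have h2 := h.2
    simp_rw [hmap _ _ (by fun_prop : Continuous fun x : ℝ => Real.exp (z * x))] at h2
    exact h2
  -- Step 5: identification of the limit
  obtain ⟨v, hv0, hv⟩ := exists_variance_of_tendsto_mgf
    (Mlim := fun z => ∫ x, Real.exp (z * x) ∂ν)
    (Eventually.of_forall fun k => integral_nonneg fun σ => sq_nonneg _)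
    hcore (fun z => (hlimit z).2)
  exact ⟨v.toNNReal, eq_gaussianReal_of_mgf_eq hv0 (fun z => (hlimit z).1) hv⟩

/-- **`aizenmanDuminilCopin_gaussian_limit` from ADC Prop. 1.4 (proof form) and uniqueness of the
critical state** (the variance bound of p. 6, `⟨T_{f,L}²⟩ ≤ C r_f² ‖f‖²_∞`, is then a theorem:
`integral_normalizedField_sq_le` for the translation-invariant free state). [cite: AizenmanDuminilCopinAnnals2021, arXiv:1912.07973 Prop. 1.4 and p. 6] -/
theorem aizenmanDuminilCopin_gaussian_limit_of_bound_abs_of_unique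
    (h₁ : aizenmanDuminilCopin_mgf_normalizedField_bound_abs)
    (hU : hasUniqueGibbsMeasure_criticalBeta (d := 4)) : aizenmanDuminilCopin_gaussian_limit := by
  refine aizenmanDuminilCopin_gaussian_limit_of_bound_abs_of_variance h₁ fun μ hμ g hg hgs => ?_
  haveI : IsProbabilityMeasure μ := ((mem_isingGibbsMeasures_iff _ _ _ _).1 hμ).isProbabilityMeasure
  obtain ⟨hTI, hG⟩ := isingGibbsMeasure_criticalBeta_structure hU (by norm_num) hμ
  obtain ⟨r, hr1, hgr⟩ := exists_cube_of_hasCompactSupport g hgs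
  exact ⟨_, fun L hL => integral_normalizedField_sq_le μ hTI hG hg hr1 hgr hL⟩

/-- **`aizenmanDuminilCopin_gaussian_limit` from the two printed estimates** (ADC Prop. 1.4 in
proof form and the variance bounds of p. 6, `normalizedField_variance_bounds`). [cite: AizenmanDuminilCopinAnnals2021, arXiv:1912.07973 Prop. 1.4 and p. 6] -/
theorem aizenmanDuminilCopin_gaussian_limit_of_bounds
    (h₁ : aizenmanDuminilCopin_mgf_normalizedField_bound_abs) (h₂ : normalizedField_variance_bounds) :
    aizenmanDuminilCopin_gaussian_limit := by
  refine aizenmanDuminilCopin_gaussian_limit_of_bound_abs_of_variance h₁ fun μ hμ g hg hgs => ?_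
  obtain ⟨C, hC⟩ := (h₂ (d := 4) le_rfl g hg hgs).1
  exact ⟨C, fun L hL => hC (criticalBeta 4) L (criticalBeta_nonneg 4) le_rfl hL μ hμ⟩

/-- **`aizenmanDuminilCopin_gaussian_limit` from the single named fact
`aizenmanDuminilCopin_mgf_normalizedField_bound_abs`**: uniqueness of the critical Gibbs measure
on `ℤ⁴` is a theorem of the tree (`hasUniqueGibbsMeasure_criticalBeta_holds`,
Aizenman–Duminil-Copin–Sidoravicius 2015 via the infrared bound), so the marginal-triviality
statement of `Sweep1` (critical 4-D Ising, Thm. 1.2 of ADC for the Ising case) rests on ADC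
Prop. 1.4 alone. [cite: AizenmanDuminilCopinAnnals2021, arXiv:1912.07973 Thm. 1.2 via Prop. 1.4 (p. 6)] -/
theorem aizenmanDuminilCopin_gaussian_limit_of_bound_abs
    (h₁ : aizenmanDuminilCopin_mgf_normalizedField_bound_abs) : aizenmanDuminilCopin_gaussian_limit :=
  aizenmanDuminilCopin_gaussian_limit_of_bound_abs_of_unique h₁ hasUniqueGibbsMeasure_criticalBeta_holds

/-! ### The trust base of `aizenmanDuminilCopin_gaussian_limit`: two compositions of record

(Split review, 2026-08-15.) `aizenmanDuminilCopin_gaussian_limit` needs, beyond theorems of the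
tree, exactly the `d = 4` bound on `Σ_L⁻² ∑ |U₄|` in the critical window
(`aizenmanDuminilCopin_ursellFourSum_le`, ADC §6.3), equivalently the paper's numbered Theorems 1.3
and 5.6 from which `ImprovedTreeDiagramBoundSum` derives it. No definition and no named fact is
introduced. -/

open Literature.Probability.LatticeModels in
/-- **`aizenmanDuminilCopin_gaussian_limit` from the single in-proof display of ADC §6.3**
(`Σ_L⁻² ∑_{Λ_{rL}⁴} |U₄| ≤ C r¹² (log L)^{-c}` in the critical window,
`aizenmanDuminilCopin_ursellFourSum_le`): ADC Prop. 1.4 in proof form follows from it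
(`aizenmanDuminilCopin_mgf_normalizedField_bound_abs_of_wickDeviation`) given Aizenman 1982,
Prop. 12.1 (`aizenman_wickDeviation_le_finite_holds`, a theorem) and uniqueness of the Gibbs state
below and at `β_c` (`hasUniqueGibbsMeasure_of_lt_criticalBeta_holds`,
`hasUniqueGibbsMeasure_criticalBeta_holds`, theorems), and the Gaussian limit from Prop. 1.4
(`aizenmanDuminilCopin_gaussian_limit_of_bound_abs`). A reduction, not a new fact.
[cite: AizenmanDuminilCopinAnnals2021, arXiv:1912.07973 Thm 1.2 via Prop. 1.4 (p. 6) and §6.3 (p. 26)] -/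
theorem aizenmanDuminilCopin_gaussian_limit_of_ursellFourSum_le
    (hS₄ : aizenmanDuminilCopin_ursellFourSum_le) : aizenmanDuminilCopin_gaussian_limit :=
  aizenmanDuminilCopin_gaussian_limit_of_bound_abs
    (aizenmanDuminilCopin_mgf_normalizedField_bound_abs_of_wickDeviation
      aizenman_wickDeviation_le_finite_holds hS₄
      (fun {_} {_} => hasUniqueGibbsMeasure_of_lt_criticalBeta_holds)
      (fun {_} => hasUniqueGibbsMeasure_criticalBeta_holds))

open Literature.Probability.LatticeModels in
/-- **`aizenmanDuminilCopin_gaussian_limit` from the numbered theorems of ADC — the current trust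
base of constructive-qft.S24:** Theorem 1.3 (improved tree diagram bound,
`aizenmanDuminilCopin_improvedTreeDiagramBound`) and Theorem 5.6 (sliding-scale infrared bound,
`aizenmanDuminilCopin_slidingScaleInfraredBound`), through the §6.3 summation
`aizenmanDuminilCopin_ursellFourSum_le_of_facts` (`ImprovedTreeDiagramBoundSum`); everything else
(Aizenman's Prop. 12.1, the tree diagram bound, the infrared bound, uniqueness below and at `β_c`,
the free state, flip symmetry, the variance bound and the moment-generating-function assembly) is a
theorem of the tree. The discharge `aizenmanDuminilCopin_gaussian_limit_holds` is this theorem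
applied to the two `_holds` once they land. A reduction, not a new fact.
[cite: AizenmanDuminilCopinAnnals2021, arXiv:1912.07973 Thm 1.2 via Thm 1.3 (p. 6), Thm 5.6 (p. 18) and §6.3 (pp. 26–27)] -/
theorem aizenmanDuminilCopin_gaussian_limit_of_adcTheorems
    (h13 : aizenmanDuminilCopin_improvedTreeDiagramBound)
    (h56 : aizenmanDuminilCopin_slidingScaleInfraredBound) : aizenmanDuminilCopin_gaussian_limit :=
  aizenmanDuminilCopin_gaussian_limit_of_ursellFourSum_le
    (aizenmanDuminilCopin_ursellFourSum_le_of_facts h13 h56)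


/-! ### The minimal input: an `o(1)` deviation of the exponential moments at `β_c`

(2026-08-15, session 2 of the `provefact` unit.) After the discharges of Aizenman's Prop. 12.1
(`aizenman_wickDeviation_le_finite_holds`), uniqueness below and at `β_c`
(`hasUniqueGibbsMeasure_of_lt_criticalBeta_holds`, `hasUniqueGibbsMeasure_criticalBeta_holds`), the
flip symmetry (`oddSpinCorrelation_eq_zero_holds`) and the sliding-scale infrared bound
(`aizenmanDuminilCopin_slidingScaleInfraredBound_holds`, ADC Thm 5.6), the summed third display of
ADC §6.3 holds unconditionally for every DLR state (`abs_mgf_normalizedField_sub_exp_le_dlr`):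
`|⟨e^{zT_{f,L}}⟩ - e^{z²⟨T_{f,L}²⟩/2}| ≤ e^{z²⟨T_{|f|,L}²⟩/2} · 24 ‖f‖_∞⁴ S(μ; L, r) z⁴` with
`S(μ; L, r) = Σ_L⁻² ∑_{Λ_{rL}⁴} |U₄|` (`ursellFourSum`). Consequently the `Sweep1` fact needs from
the four-dimensional analysis only that `S(μ; L, r) → 0` as `L → ∞` for the critical state and
every fixed `r ≥ 1` (`aizenmanDuminilCopin_gaussian_limit_of_tendsto_ursellFourSum`), which is
what either of the two vendored forms of the `d = 4` logarithmic improvement delivers: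
ADC Thm 1.3 (`aizenmanDuminilCopin_gaussian_limit_of_improvedTreeDiagramBound`, Thm 5.6 being a
theorem now) or Panis's Cor. 1.8 (`aizenmanDuminilCopin_gaussian_limit_of_panis_four`, the single
named fact of the crit-ising.S13 trust base, `HighDimTrivialityAssemblyProofs`). The abstract core
`aizenmanDuminilCopin_gaussian_limit_of_mgf_deviation` isolates the probabilistic argument of
ADC p. 6 from the shape of the error term. No definition and no named fact is introduced. -/

/-- **The Gaussianity argument of ADC p. 6 with an abstract error term.** Suppose that for every
critical DLR state `μ` on `ℤ⁴`, every `f ∈ C(ℝ⁴)` vanishing outside `[-r, r]⁴` (`r ≥ 1`) and every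
real `z` there is `ε = ε_{μ,f,r,z}` with `ε(L) → 0` (`L → ∞`) and, for `L > 1`,
`|⟨e^{z T_{f,L}}⟩_μ - e^{z²⟨T_{f,L}²⟩_μ/2}| ≤ e^{z²⟨T_{|f|,L}²⟩_μ/2} ε(L)`. Then every subsequential
weak limit of the law of `T_{f,L_k}` is a centred Gaussian (`aizenmanDuminilCopin_gaussian_limit`):
the variances `⟨T_{g,L}²⟩`, `g = f, |f|`, are bounded (`integral_normalizedField_sq_le` for the
translation-invariant critical state with non-negative pair correlations — uniqueness at `β_c` is the
theorem `hasUniqueGibbsMeasure_criticalBeta_holds`), so `⟨e^{zT_k}⟩ e^{-z²⟨T_k²⟩/2} → 1` with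
uniformly bounded exponential moments; weak convergence then gives convergence of `⟨e^{zT_k}⟩`
(`tendsto_integral_of_tendsto_of_sq_le`), the limit is `e^{vz²/2}` (`exists_variance_of_tendsto_mgf`)
and the limit law is `N(0, v)` (`eq_gaussianReal_of_mgf_eq`). [cite: AizenmanDuminilCopinAnnals2021, arXiv:1912.07973 p. 6 (after Prop. 1.4) and Thm 1.2 (p. 4)] -/
theorem aizenmanDuminilCopin_gaussian_limit_of_mgf_deviation
    (hdev : ∀ μ ∈ isingGibbsMeasures 4 (criticalBeta 4) 0, ∀ (f : EuclideanSpace ℝ (Fin 4) → ℝ) (r : ℝ),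
      Continuous f → 1 ≤ r → (∀ x, f x ≠ 0 → ∀ i, |x i| ≤ r) → ∀ z : ℝ,
      ∃ ε : ℝ → ℝ, Tendsto ε atTop (𝓝 0) ∧ ∀ L : ℝ, 1 < L →
        |(∫ σ, Real.exp (z * normalizedField μ L f σ) ∂μ) -
            Real.exp (z ^ 2 / 2 * ∫ σ, normalizedField μ L f σ ^ 2 ∂μ)|
          ≤ Real.exp (z ^ 2 / 2 * ∫ σ, normalizedField μ L (fun x => |f x|) σ ^ 2 ∂μ) * ε L) :
    aizenmanDuminilCopin_gaussian_limit := by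
  intro μ hμ f hf hfc L hL ν hν hlim
  haveI : IsProbabilityMeasure μ := ((mem_isingGibbsMeasures_iff _ _ _ _).1 hμ).isProbabilityMeasure
  obtain ⟨r, hr1, hfr⟩ := exists_cube_of_hasCompactSupport f hfc
  -- variance bounds from the structure of the (unique) critical state
  obtain ⟨hTI, hG⟩ := isingGibbsMeasure_criticalBeta_structure hasUniqueGibbsMeasure_criticalBeta_holds
    (by norm_num) hμ
  set Cf : ℝ := (⨆ x, |f x|) ^ 2 * ((((2 * (⌈r⌉₊ + 1) + 1) ^ 4 : ℕ) : ℝ) ^ 2) with hCf_def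
  set Ca : ℝ := (⨆ x, |(fun y => |f y|) x|) ^ 2 * ((((2 * (⌈r⌉₊ + 1) + 1) ^ 4 : ℕ) : ℝ) ^ 2)
    with hCa_def
  have hfa : Continuous fun y => |f y| := hf.abs
  have hfra : ∀ x, (fun y => |f y|) x ≠ 0 → ∀ i, |x i| ≤ r := fun x hx => hfr x (by simpa using hx)
  -- the shifted scales `L (k+1) ≥ 1`, tending to infinity
  have hLk : ∀ k, 1 ≤ L (k + 1) := fun k => (Nat.succ_le_succ (Nat.zero_le k)).trans (hL.id_le _)
  have hL0 : ∀ k, L (k + 1) ≠ 0 := fun k => Nat.one_le_iff_ne_zero.mp (hLk k)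
  have hL1 : ∀ k, (1 : ℝ) ≤ (L (k + 1) : ℝ) := fun k => by exact_mod_cast hLk k
  have hLtop : Tendsto (fun k => ((L (k + 1) : ℕ) : ℝ)) atTop atTop :=
    tendsto_natCast_atTop_atTop.comp (hL.tendsto_atTop.comp (tendsto_add_atTop_nat 1))
  -- the fields `T_k = adcField μ f (L (k+1)) = normalizedField μ (L (k+1)) f`
  set T : ℕ → SpinConfig (Literature.Probability.LatticeModels.Site 4) → ℝ :=
    fun k σ => normalizedField μ (L (k + 1) : ℝ) f σ with hT_def
  have hT : ∀ k σ, adcField μ f (L (k + 1)) σ = T k σ := fun k σ =>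
    adcField_eq_normalizedField μ hfr (hL0 k) σ
  have hX : ∀ k, AEMeasurable (T k) μ := fun k =>
    (measurable_normalizedField μ (Nat.cast_ne_zero.mpr (hL0 k)) hfr).aemeasurable
  have hVle : ∀ k, ∫ σ, T k σ ^ 2 ∂μ ≤ Cf := fun k =>
    integral_normalizedField_sq_le μ hTI hG hf hr1 hfr (hL1 k)
  have hWle : ∀ k, ∫ σ, normalizedField μ (L (k + 1) : ℝ) (fun x => |f x|) σ ^ 2 ∂μ ≤ Ca :=
    fun k => integral_normalizedField_sq_le μ hTI hG hfa hr1 hfra (hL1 k)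
  -- Step 1: `M_k(z) e^{-z² V_k/2} - 1 → 0` from the abstract deviation bound
  have hcore : ∀ z : ℝ, Tendsto (fun k =>
      (∫ σ, Real.exp (z * T k σ) ∂μ) * Real.exp (-(z ^ 2 * (∫ σ, T k σ ^ 2 ∂μ) / 2)) - 1)
      atTop (𝓝 0) := by
    intro z
    obtain ⟨ε, hε, H⟩ := hdev μ hμ f r hf hr1 hfr z
    have hu : Tendsto (fun k => ε ((L (k + 1) : ℕ) : ℝ)) atTop (𝓝 0) := hε.comp hLtop
    have hev : ∀ᶠ k in atTop, (1 : ℝ) < ((L (k + 1) : ℕ) : ℝ) := hLtop.eventually (eventually_gt_atTop 1)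
    refine squeeze_zero_norm' (a := fun k => Real.exp (z ^ 2 / 2 * Ca) * ‖ε ((L (k + 1) : ℕ) : ℝ)‖)
      (hev.mono fun k hk => ?_) (by simpa using (tendsto_const_nhds.mul hu.norm))
    have hest := H _ hk
    set s : ℝ := z ^ 2 / 2 * ∫ σ, T k σ ^ 2 ∂μ with hs_def
    have hs : z ^ 2 * (∫ σ, T k σ ^ 2 ∂μ) / 2 = s := by rw [hs_def]; ring
    have hs0 : 0 ≤ s := mul_nonneg (by positivity) (integral_nonneg fun σ => sq_nonneg _)
    have hkey : ∀ M : ℝ, |M * Real.exp (-s) - 1| ≤ |M - Real.exp s| := by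
      intro M
      have h1 : M * Real.exp (-s) - 1 = Real.exp (-s) * (M - Real.exp s) := by
        rw [mul_sub, Real.exp_neg, ← mul_comm M, inv_mul_cancel₀ (Real.exp_pos s).ne']
      rw [h1, abs_mul, Real.abs_exp]
      exact mul_le_of_le_one_left (abs_nonneg _) (Real.exp_le_one_iff.mpr (neg_nonpos.mpr hs0))
    rw [Real.norm_eq_abs, hs]
    refine (hkey _).trans ?_
    calc |(∫ σ, Real.exp (z * T k σ) ∂μ) - Real.exp s|
        ≤ Real.exp (z ^ 2 / 2 * ∫ σ, normalizedField μ (L (k + 1) : ℝ) (fun x => |f x|) σ ^ 2 ∂μ) *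
            ε ((L (k + 1) : ℕ) : ℝ) := hest
      _ ≤ Real.exp (z ^ 2 / 2 * ∫ σ, normalizedField μ (L (k + 1) : ℝ) (fun x => |f x|) σ ^ 2 ∂μ) *
            ‖ε ((L (k + 1) : ℕ) : ℝ)‖ :=
          mul_le_mul_of_nonneg_left (Real.le_norm_self _) (Real.exp_pos _).le
      _ ≤ Real.exp (z ^ 2 / 2 * Ca) * ‖ε ((L (k + 1) : ℕ) : ℝ)‖ := by
          gcongr
          exact hWle k
  -- Step 2: uniformly bounded exponential moments, eventually `M_k(z) ≤ 2 e^{z² Cf/2}`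
  have hbound : ∀ z : ℝ, ∀ᶠ k in atTop,
      (∫ σ, Real.exp (z * T k σ) ∂μ) ≤ 2 * Real.exp (z ^ 2 * Cf / 2) := by
    intro z
    have h2 : ∀ᶠ k in atTop, (∫ σ, Real.exp (z * T k σ) ∂μ) *
        Real.exp (-(z ^ 2 * (∫ σ, T k σ ^ 2 ∂μ) / 2)) - 1 < 1 :=
      (hcore z).eventually (gt_mem_nhds one_pos)
    filter_upwards [h2] with k hk
    have hlt : (∫ σ, Real.exp (z * T k σ) ∂μ) *
        Real.exp (-(z ^ 2 * (∫ σ, T k σ ^ 2 ∂μ) / 2)) < 2 := by linarith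
    rw [Real.exp_neg, ← div_eq_mul_inv, div_lt_iff₀ (Real.exp_pos _)] at hlt
    refine hlt.le.trans ?_
    have := hVle k
    gcongr
  -- Step 3: laws and weak convergence (from `hlim`, along the shifted sequence)
  let νk : ℕ → ProbabilityMeasure ℝ := fun k =>
    ⟨μ.map (T k), Measure.isProbabilityMeasure_map (hX k)⟩
  let ν₀ : ProbabilityMeasure ℝ := ⟨ν, hν⟩
  have hmap : ∀ k (F : ℝ → ℝ), Continuous F →
      ∫ x, F x ∂(νk k : Measure ℝ) = ∫ σ, F (T k σ) ∂μ := fun k F hF => by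
    simp only [νk, ProbabilityMeasure.coe_mk]
    exact integral_map (hX k) hF.aestronglyMeasurable
  have hνk : Tendsto νk atTop (𝓝 ν₀) := by
    refine ProbabilityMeasure.tendsto_iff_forall_integral_tendsto.mpr fun g => ?_
    have h := (hlim g g.continuous g.isBounded_range).comp (tendsto_add_atTop_nat 1)
    simp only [ν₀, ProbabilityMeasure.coe_mk]
    refine (h.congr fun k => ?_)
    simp only [Function.comp_apply, hT, hmap k g g.continuous]
  -- Step 4: `M_k(z) → ∫ e^{zx} dν(x)`, finite
  have hlimit : ∀ z : ℝ, Integrable (fun x => Real.exp (z * x)) ν ∧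
      Tendsto (fun k => ∫ σ, Real.exp (z * T k σ) ∂μ) atTop (𝓝 (∫ x, Real.exp (z * x) ∂ν)) := by
    intro z
    have hsq : ∀ x : ℝ, Real.exp (z * x) ^ 2 = Real.exp (2 * z * x) := fun x => by
      rw [sq, ← Real.exp_add]
      ring_nf
    have hB : ∀ᶠ k in atTop, Integrable (fun x => Real.exp (z * x) ^ 2) (νk k : Measure ℝ) ∧
        ∫ x, Real.exp (z * x) ^ 2 ∂(νk k : Measure ℝ) ≤ 2 * Real.exp ((2 * z) ^ 2 * Cf / 2) := by
      filter_upwards [hbound (2 * z)] with k hk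
      simp_rw [hsq]
      refine ⟨?_, ?_⟩
      · simp only [νk, ProbabilityMeasure.coe_mk]
        refine (integrable_map_measure (by fun_prop) (hX k)).mpr ?_
        exact integrable_exp_mul_normalizedField μ (Nat.cast_ne_zero.mpr (hL0 k)) hfr (2 * z)
      · rw [hmap k _ (by fun_prop)]
        exact hk
    have h := tendsto_integral_of_tendsto_of_sq_le hνk (by fun_prop) (fun x => (Real.exp_pos _).le) hB
    simp only [ν₀, ProbabilityMeasure.coe_mk] at h
    refine ⟨h.1, ?_⟩
    have h2 := h.2
    simp_rw [hmap _ _ (by fun_prop : Continuous fun x : ℝ => Real.exp (z * x))] at h2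
    exact h2
  -- Step 5: identification of the limit
  obtain ⟨v, hv0, hv⟩ := exists_variance_of_tendsto_mgf
    (Mlim := fun z => ∫ x, Real.exp (z * x) ∂ν)
    (Eventually.of_forall fun k => integral_nonneg fun σ => sq_nonneg _)
    hcore (fun z => (hlimit z).2)
  exact ⟨v.toNNReal, eq_gaussianReal_of_mgf_eq hv0 (fun z => (hlimit z).1) hv⟩

open Literature.Probability.LatticeModels in
/-- **`aizenmanDuminilCopin_gaussian_limit` from `S(μ; L, r) → 0` at `β_c`.** If for every critical
DLR state `μ` on `ℤ⁴` and every `r ≥ 1` the normalised sum of `|U₄|` over `Λ_{rL}⁴`,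
`S(μ; L, r) = Σ_L⁻² ∑ |U₄|` (`ursellFourSum`), tends to `0` as `L → ∞`, then every subsequential
scaling limit of `T_{f,L}` is Gaussian: the summed form of Aizenman's Prop. 12.1 for DLR states,
`abs_mgf_normalizedField_sub_exp_le_dlr` (a theorem: ADC §6.3, third display), supplies the error
term `24 ‖f‖_∞⁴ S(μ; L, r) z⁴` of `aizenmanDuminilCopin_gaussian_limit_of_mgf_deviation`. This is
the exact interface between the `Sweep1` fact and the four-dimensional analysis (ADC Thm 1.3 /
Panis Cor. 1.8). [cite: AizenmanDuminilCopinAnnals2021, arXiv:1912.07973 §6.3 (p. 26) and p. 6] -/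
theorem aizenmanDuminilCopin_gaussian_limit_of_tendsto_ursellFourSum
    (hS : ∀ μ ∈ isingGibbsMeasures 4 (criticalBeta 4) 0, ∀ r : ℝ, 1 ≤ r →
      Tendsto (fun L : ℝ => ursellFourSum μ L r) atTop (𝓝 0)) :
    aizenmanDuminilCopin_gaussian_limit := by
  refine aizenmanDuminilCopin_gaussian_limit_of_mgf_deviation fun μ hμ f r hf hr1 hfr z => ?_
  refine ⟨fun L => 24 * (⨆ x, |f x|) ^ 4 * ursellFourSum μ L r * z ^ 4, ?_, fun L hL => ?_⟩
  · have h := ((hS μ hμ r hr1).const_mul (24 * (⨆ x, |f x|) ^ 4)).mul_const (z ^ 4)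
    simpa using h
  · exact abs_mgf_normalizedField_sub_exp_le_dlr (d := 4) (by norm_num) (criticalBeta_nonneg 4) le_rfl
      (one_pos.trans hL) hμ hf hfr z

open Literature.Probability.LatticeModels in
/-- **`S(μ; L, r) → 0` at `β_c` from a bound `S ≤ C r^γ (log L)^{-c}` for `L > 1`** (the common
shape of ADC §6.3 and Panis Cor. 1.8 at the critical point, where both scaling windows are all of
`L > 1`). [folklore] -/
theorem tendsto_ursellFourSum_of_log_bound {μ : Measure (SpinConfig (Literature.Probability.LatticeModels.Site 4))}
    {r K c : ℝ} (hc : 0 < c)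
    (h : ∀ L : ℝ, 1 < L → ursellFourSum μ L r ≤ K / Real.log L ^ c) :
    Tendsto (fun L : ℝ => ursellFourSum μ L r) atTop (𝓝 0) := by
  have hu : Tendsto (fun L : ℝ => K / Real.log L ^ c) atTop (𝓝 0) := by
    have h1 : Tendsto (fun L : ℝ => (Real.log L ^ c)⁻¹) atTop (𝓝 0) :=
      tendsto_inv_atTop_zero.comp ((tendsto_rpow_atTop hc).comp Real.tendsto_log_atTop)
    simpa [div_eq_mul_inv] using h1.const_mul K
  refine squeeze_zero' (Eventually.of_forall fun L => ursellFourSum_nonneg μ L r) ?_ hu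
  filter_upwards [eventually_gt_atTop 1] with L hL using h L hL

open Literature.Probability.LatticeModels in
/-- **`aizenmanDuminilCopin_gaussian_limit` from Panis's Corollary 1.8 alone** — the single named
fact of the current trust base of crit-ising.S13 (`panis_ursellFourSum_le_four`,
`HighDimTrivialityUniform`; Panis, Ann. Probab. 54 (2026) = arXiv:2309.05797, Cor. 1.8 with §6.6:
the `d = 4` bound `Σ_L⁻² ∑_{Λ_{rL}⁴} |U₄| ≤ C r^γ (log L)^{-c}` in the sharp-length window, which
at `β = β_c` is every `L > 1`). With this the `Sweep1` fact (constructive-qft.S24, critical 4-D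
Ising) and crit-ising.S13 rest on the same single input. A reduction, not a new fact.
[cite: Panis2023Triviality, Cor. 1.8 with its proof §6.6 (p. 33)] [cite: AizenmanDuminilCopinAnnals2021, arXiv:1912.07973 Thm 1.2 (p. 4)] -/
theorem aizenmanDuminilCopin_gaussian_limit_of_panis_four (hP₄ : panis_ursellFourSum_le_four) :
    aizenmanDuminilCopin_gaussian_limit := by
  refine aizenmanDuminilCopin_gaussian_limit_of_tendsto_ursellFourSum fun μ hμ r hr1 => ?_
  obtain ⟨C, c, γ, -, hc, -, H⟩ := hP₄
  exact tendsto_ursellFourSum_of_log_bound hc fun L hL =>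
    H (criticalBeta 4) L r (criticalBeta_nonneg 4) le_rfl hL hr1 (Or.inl rfl) μ hμ

open Literature.Probability.LatticeModels in
/-- **`aizenmanDuminilCopin_gaussian_limit` from ADC Theorem 1.3 alone** (the improved tree
diagram bound, `aizenmanDuminilCopin_improvedTreeDiagramBound`): Theorem 5.6 (sliding-scale
infrared bound) is now the theorem `aizenmanDuminilCopin_slidingScaleInfraredBound_holds`
(`SlidingScaleInfraredBoundProofs`), so the two-fact reduction
`aizenmanDuminilCopin_gaussian_limit_of_adcTheorems` closes up to Thm 1.3. The discharge
`aizenmanDuminilCopin_gaussian_limit_holds` is this theorem applied to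
`aizenmanDuminilCopin_improvedTreeDiagramBound_holds` once that lands (or
`aizenmanDuminilCopin_gaussian_limit_of_panis_four` applied to `panis_ursellFourSum_le_four_holds`).
A reduction, not a new fact. [cite: AizenmanDuminilCopinAnnals2021, arXiv:1912.07973 Thm 1.2 via Thm 1.3 (p. 6), Thm 5.6 (p. 18), §6.3 (pp. 26–27)] -/
theorem aizenmanDuminilCopin_gaussian_limit_of_improvedTreeDiagramBound
    (h13 : aizenmanDuminilCopin_improvedTreeDiagramBound) : aizenmanDuminilCopin_gaussian_limit :=
  aizenmanDuminilCopin_gaussian_limit_of_adcTheorems h13 aizenmanDuminilCopin_slidingScaleInfraredBound_holds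

open Literature.Probability.LatticeModels in
/-- **Aizenman–Duminil-Copin 2021, Theorem 1.2 at `β = β_c` (Gaussianity of every scaling limit of the
critical 4-D nearest-neighbour Ising model) — discharged**: the named fact
`aizenmanDuminilCopin_gaussian_limit` of `Sweep1` (constructive-qft.S24) holds. The proof is the paper's:
Theorem 1.3 (improved tree diagram bound, now the theorem
`aizenmanDuminilCopin_improvedTreeDiagramBound_holds`, `ImprovedTreeDiagramBoundHolds`) and Theorem 5.6
(sliding-scale infrared bound, `aizenmanDuminilCopin_slidingScaleInfraredBound_holds`) give, through the
§6.3 moment-generating-function estimate (Prop. 1.4 in its proved form) and the variance window at `β_c`,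
an `o(1)` deviation of the law of `T_{f,L}` from a centred Gaussian, whence every subsequential weak limit
is `gaussianReal 0 v` (`aizenmanDuminilCopin_gaussian_limit_of_improvedTreeDiagramBound`). Equivalently
`aizenmanDuminilCopin_gaussian_limit_of_panis_four panis_ursellFourSum_le_four_holds`
(Panis, Ann. Probab. 54 (2026), Cor. 1.8, itself discharged from Thm 1.3 in the tree).
[cite: AizenmanDuminilCopinAnnals2021, arXiv:1912.07973 Thm 1.2 (p. 4) with p. 5 ("for d = 4 any scaling limit of the
critical Ising model is Gaussian"); proof: Thm 1.3 (p. 6), Prop. 1.4 (p. 6), Thm 5.6 (p. 18), §6.3 (pp. 26–27)] -/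
theorem aizenmanDuminilCopin_gaussian_limit_holds : aizenmanDuminilCopin_gaussian_limit :=
  aizenmanDuminilCopin_gaussian_limit_of_improvedTreeDiagramBound
    aizenmanDuminilCopin_improvedTreeDiagramBound_holds

end Literature.MathematicalPhysics.QuantumFieldTheory

end
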